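import Summits.MatrixMultiplication.OmegaCensus.STPPSmallPatternT2Below24
import Summits.MatrixMultiplication.OmegaCensus.STPPSmallPatternNone122K4Z24
import Summits.MatrixMultiplication.OmegaCensus.STPPSmallPatternNone122K4Z25
import Summits.MatrixMultiplication.OmegaCensus.STPPSmallPatternNone122K4P5x5
import Summits.MatrixMultiplication.OmegaCensus.STPPSmallPatternNone122K4Z26
import Summits.MatrixMultiplication.OmegaCensus.STPPSmallPatternNone122K4Z27
import Summits.MatrixMultiplication.OmegaCensus.STPPSmallPatternNone122K4P2x12
import Summits.MatrixMultiplication.OmegaCensus.STPPSmallPatternNone122K4P2x2x6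
import Summits.MatrixMultiplication.OmegaCensus.STPPSmallPatternNone122K4P3x9
import Summits.MatrixMultiplication.OmegaCensus.STPPSmallPatternNone122K4P3x3x3
import Summits.MatrixMultiplication.OmegaCensus.STPPSmallPatternT2K4Order32
import Summits.MatrixMultiplication.OmegaCensus.STPP222CubeNoneBelow32
import Summits.MatrixMultiplication.OmegaCensus.STPPSmallPatternTableWitnessesT2B

/-!
# ω-census, small STPP pattern `(1,2,2)^k`: NO finite abelian group of order `≤ 27` admits `(1,2,2)⁴` (kernel)

HONEST FRAMING (pub-omega census; verbatim): lottery ticket; floor = certified bounds/negative ranges.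
Census STRUCTURE bookkeeping of the STPP track (seat pub-omega-stpp-3, gen 24; STRUCTURE row B5: the threshold column
`T2(H) = max {k : (1,2,2)^k ⊆ H}`), not progress on `ω`: small patterns in small groups bound no exponent.

CAPSTONE of the `(1,2,2)⁴` kernel cells (`STPPSmallPatternNone122K4*.lean`: `ℤ/24`, `ℤ/25`, `ℤ/5²`, `ℤ/26`, `ℤ/27` of gen 23
by the chunked search; `ℤ/2 × ℤ/12`, `ℤ/2² × ℤ/6`, `ℤ/3 × ℤ/9`, `(ℤ/3)³` of gen 24 by the automorphism-reduced search of
`STPPSmallPatternKernelReflect122S.lean`), over ALL finite abelian groups: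
* `not_exists_isSTPP_122pow4_of_card_le` — **no finite abelian group of order `≤ 27` admits an STPP family of size pattern
  `(1,2,2)⁴`**; with `(1,2,2)⁴ ⊆ ℤ/2 × ℤ/16` (`STPPSmallPatternT2K4Order32.lean`): the all-abelian onset of `(1,2,2)⁴` lies in
  `[28, 32]` (`stpp122pow4_onset_bounds`; the engines say `32`, orders `28 … 31` are not kernel cells yet);
* `stpp122_T2_eq_3_orders_24_27` — **`T2 = 3` EXACTLY for each of the nine abelian groups of order `24 … 27`** (kernel both
  ways; `(1,2,2)³` witnesses from the cell files and `STPPSmallPatternTableWitnessesT2B.lean`).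
The structure-theorem bridge is the one of `STPPSmallPatternT2Below24.lean`, re-run on the prime-power list `ppList` / caps
`capList` of `STPP222CubeFrom46.lean` with the capping lemma `le_capMS_of_prod_le45` of `STPP222CubeNoneBelow32.lean`
(valid up to order `45`, `not_exists_isSTPP_122_of_card_le_hi45`) so that the orders
`25 = 5²` and `27 = 3³` are reachable; orders below `2k` by disjointness of the `B`-pairs; cyclic composite orders through
the CRT (`SeedType` transports).

References: H. Cohn, R. Kleinberg, B. Szegedy, C. Umans, FOCS 2005 (arXiv:math/0511460), Def. 5.1.  Record: pub-omega HOME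
`pub-omega-stpp-3-g24/`; engine cross-checks (not used): lister122.c (stpp-3 gen 22) and t2dfs.c (ENG2 gen 31) both report
`T2 = 3` on every abelian group of order `24 … 31`.
-/

open Literature.Computability.AlgebraicComplexity Finset

namespace Summit.MatrixMultiplication.OmegaCensus

/-! ## 1. The structure-theorem bridge up to order `45` -/

/-- **The bridge, `(1,2,2)` version, orders up to `45`**: a kernel domination core over `[2k, hi]` (`hi ≤ 45`, prime powers
and caps of `STPP222CubeFrom46.lean`) plus the exclusions of the listed seed groups exclude every finite abelian group of
order `≤ hi`. [cite: CohnKleinbergSzegedyUmans2005, Def. 5.1] -/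
theorem not_exists_isSTPP_122_of_card_le_hi45 {k hi : ℕ} (hhi : hi ≤ 45) {L : List (List ℕ)}
    (hcore : ∀ E ∈ List.range' 1 hi, ∀ M ∈ subMS (capList E), 2 * k ≤ M.prod → M.prod ≤ hi →
      ∃ s ∈ L, dom s M = true ∧ s.prod = M.prod)
    (hnone : ∀ s ∈ L, ¬ ∃ A B C : Fin k → Finset (SeedType s), IsSTPP A B C ∧
      ∀ i, (A i).card = 1 ∧ (B i).card = 2 ∧ (C i).card = 2)
    {G : Type*} [AddCommGroup G] [Finite G] (hG : Nat.card G ≤ hi) :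
    ¬ ∃ A B C : Fin k → Finset G, IsSTPP A B C ∧ ∀ i, (A i).card = 1 ∧ (B i).card = 2 ∧ (C i).card = 2 := by
  classical
  rintro ⟨A, B, C, hS, hc⟩
  have hlo : 2 * k ≤ Nat.card G := two_mul_le_natCard_of_isSTPP_122 ⟨A, B, C, hS, hc⟩
  obtain ⟨ι, _, p, hp, e, ⟨g⟩⟩ := AddCommGroup.equiv_directSum_zmod_of_finite G
  let f : G ≃+ (Π i, ZMod (p i ^ e i)) :=
    g.trans (DirectSum.linearEquivFunOnFintype ℕ ι (fun i => ZMod (p i ^ e i))).toAddEquiv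
  have hE1 : 1 ≤ AddMonoid.exponent G := Nat.pos_of_ne_zero AddMonoid.exponent_ne_zero_of_finite
  have hEle : AddMonoid.exponent G ≤ hi :=
    le_trans (Nat.le_of_dvd Nat.card_pos AddGroup.exponent_dvd_nat_card) hG
  have hdvd : ∀ i, p i ^ e i ∣ AddMonoid.exponent G := fun i => by
    have hinj : Function.Injective (AddMonoidHom.single (fun j => ZMod (p j ^ e j)) i) :=
      Pi.single_injective (M := fun j => ZMod (p j ^ e j)) i
    have h1 : addOrderOf (f.symm (AddMonoidHom.single (fun j => ZMod (p j ^ e j)) i 1)) = p i ^ e i := by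
      rw [AddEquiv.addOrderOf_eq, addOrderOf_injective _ hinj, ZMod.addOrderOf_one]
    rw [← h1]
    exact AddMonoid.addOrder_dvd_exponent _
  have hcardeq : Nat.card G = ∏ i, p i ^ e i := by
    rw [Nat.card_congr f.toEquiv, Nat.card_pi]
    simp [Nat.card_zmod]
  have hq0 : ∀ i, p i ^ e i ≠ 0 := fun i => pow_ne_zero _ (hp i).ne_zero
  haveI : ∀ i, NeZero (p i ^ e i) := fun i => ⟨hq0 i⟩
  set M : Multiset ℕ := (Finset.univ.filter fun i => 0 < e i).val.map fun i => p i ^ e i with hM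
  have hprodeq : M.prod = ∏ i, p i ^ e i := by
    rw [hM, ← Finset.prod_eq_multiset_prod]
    exact Finset.prod_filter_of_ne fun i _ hi => Nat.pos_of_ne_zero fun h0 => hi (by rw [h0, pow_zero])
  have hmem : ∀ a ∈ M, a ∈ ppList ∧ a ∣ AddMonoid.exponent G := by
    intro a ha
    obtain ⟨i, hi, rfl⟩ := Multiset.mem_map.1 ha
    have hi' : 0 < e i := (Finset.mem_filter.1 hi).2
    exact ⟨pow_mem_ppList (hp i) hi' (le_trans (Nat.le_of_dvd (by omega) (hdvd i)) (le_trans hEle hhi)), hdvd i⟩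
  have hEI : AddMonoid.exponent G ∈ List.range' 1 hi := List.mem_range'_1.2 ⟨hE1, by omega⟩
  have hEI45 : AddMonoid.exponent G ∈ List.range' 1 45 := List.mem_range'_1.2 ⟨hE1, by omega⟩
  have hhiM : M.prod ≤ hi := by rw [hprodeq, ← hcardeq]; exact hG
  have hle : M ≤ capMS (capList (AddMonoid.exponent G)) :=
    le_capMS_of_prod_le45 hEI45 (fun a ha => (hmem a ha).1) (fun a ha => (hmem a ha).2) (le_trans hhiM hhi)
  obtain ⟨s, hs, hD, hsprod⟩ := hcore _ hEI M (mem_subMS_of_le _ _ hle) (by rw [hprodeq, ← hcardeq]; exact hlo) hhiM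
  obtain ⟨φ, hφ, -⟩ := exists_emb_of_dom (fun i => p i ^ e i) hq0 s _ hD
  have hcard : Nat.card (SeedType s) = Nat.card (Π i, ZMod (p i ^ e i)) := by
    rw [card_seedType, hsprod, hprodeq, Nat.card_pi]
    simp
  exact not_exists_isSTPP_122_of_card_eq φ hφ hcard (hnone s hs)
    (exists_isSTPP_122_of_injective f.toAddMonoidHom f.injective ⟨A, B, C, hS, hc⟩)

/-! ## 2. CRT transports to seed types with an inner coprime pair -/

/-- A `(1,2,2)^k` exclusion for `ℤ/a × ℤ/(m n)` (`m`, `n` coprime) read on `SeedType [a, m, n]`.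
[cite: CohnKleinbergSzegedyUmans2005, Def. 5.1] -/
theorem not_exists_isSTPP_122_seedConsPair {a m n k : ℕ} (h : m.Coprime n)
    (hneg : ¬ ∃ A B C : Fin k → Finset (ZMod a × ZMod (m * n)), IsSTPP A B C ∧
      ∀ i, (A i).card = 1 ∧ (B i).card = 2 ∧ (C i).card = 2) :
    ¬ ∃ A B C : Fin k → Finset (SeedType [a, m, n]), IsSTPP A B C ∧ ∀ i, (A i).card = 1 ∧ (B i).card = 2 ∧ (C i).card = 2 :=
  fun hex => hneg (exists_isSTPP_122_of_injective
    ((AddEquiv.refl (ZMod a)).prodCongr (ZMod.chineseRemainder h).toAddEquiv.symm).toAddMonoidHom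
    (AddEquiv.injective _) hex)

/-- A `(1,2,2)^k` exclusion for `ℤ/a × ℤ/b × ℤ/(m n)` (`m`, `n` coprime) read on `SeedType [a, b, m, n]`.
[cite: CohnKleinbergSzegedyUmans2005, Def. 5.1] -/
theorem not_exists_isSTPP_122_seedConsConsPair {a b m n k : ℕ} (h : m.Coprime n)
    (hneg : ¬ ∃ A B C : Fin k → Finset (ZMod a × (ZMod b × ZMod (m * n))), IsSTPP A B C ∧
      ∀ i, (A i).card = 1 ∧ (B i).card = 2 ∧ (C i).card = 2) :
    ¬ ∃ A B C : Fin k → Finset (SeedType [a, b, m, n]), IsSTPP A B C ∧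
      ∀ i, (A i).card = 1 ∧ (B i).card = 2 ∧ (C i).card = 2 :=
  fun hex => hneg (exists_isSTPP_122_of_injective
    ((AddEquiv.refl (ZMod a)).prodCongr ((AddEquiv.refl (ZMod b)).prodCongr
      (ZMod.chineseRemainder h).toAddEquiv.symm)).toAddMonoidHom (AddEquiv.injective _) hex)

/-! ## 3. `k = 4`: order `≤ 27` -/

/-- COMBINATORIAL CORE for `k = 4` (kernel): every capped multiset of prime powers with product in `[8, 27]` is dominated,
with equal product, by one of the lists. -/
theorem noneList122K4_of_capped : ∀ E ∈ List.range' 1 27, ∀ M ∈ subMS (capList E), 2 * 4 ≤ M.prod → M.prod ≤ 27 →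
    ∃ s ∈ (noneLists122K3 ++ [[8, 3], [2, 4, 3], [2, 2, 2, 3], [25], [5, 5], [2, 13], [27], [3, 9], [3, 3, 3]]),
      dom s M = true ∧ s.prod = M.prod := by
  decide +kernel

/-- Each listed group admits no `(1,2,2)⁴` (orders `6 … 23` lifted from `k = 3`; the nine groups of order `24 … 27` by their
kernel cells, cyclic composite orders and inner coprime pairs through the CRT). [cite: CohnKleinbergSzegedyUmans2005, Def. 5.1] -/
theorem not_122pow4_of_mem_noneLists122K4 :
    ∀ s ∈ (noneLists122K3 ++ [[8, 3], [2, 4, 3], [2, 2, 2, 3], [25], [5, 5], [2, 13], [27], [3, 9], [3, 3, 3]]),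
    ¬ ∃ A B C : Fin 4 → Finset (SeedType s),
    IsSTPP A B C ∧ ∀ i, (A i).card = 1 ∧ (B i).card = 2 ∧ (C i).card = 2 := by
  intro s hs
  rcases List.mem_append.1 hs with hs3 | hs4
  · exact not_exists_isSTPP_122_mono (by norm_num) (not_122pow3_of_mem_noneLists122K3 s hs3)
  simp only [List.mem_cons, List.mem_nil_iff, or_false] at hs4
  rcases hs4 with rfl | rfl | rfl | rfl | rfl | rfl | rfl | rfl | rfl
  · exact not_exists_isSTPP_122_seedPair (by norm_num) not_exists_isSTPP_122pow4_zmod24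
  · exact not_exists_isSTPP_122_seedConsPair (by norm_num) not_exists_isSTPP_122pow4_z2_z12
  · exact not_exists_isSTPP_122_seedConsConsPair (by norm_num) not_exists_isSTPP_122pow4_z2_z2_z6
  · exact not_exists_isSTPP_122pow4_zmod25
  · exact not_exists_isSTPP_122pow4_z5_z5
  · exact not_exists_isSTPP_122_seedPair (by norm_num) not_exists_isSTPP_122pow4_zmod26
  · exact not_exists_isSTPP_122pow4_zmod27
  · exact not_exists_isSTPP_122pow4_z3_z9
  · exact not_exists_isSTPP_122pow4_z3_z3_z3

/-- **No finite abelian group of order `≤ 27` admits an STPP family of size pattern `(1,2,2)⁴`** (CKSU Def. 5.1, tree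
`IsSTPP`; kernel).  No `ω` bound follows. [cite: CohnKleinbergSzegedyUmans2005, Def. 5.1] -/
theorem not_exists_isSTPP_122pow4_of_card_le {G : Type*} [AddCommGroup G] [Finite G] (hG : Nat.card G ≤ 27) :
    ¬ ∃ A B C : Fin 4 → Finset G, IsSTPP A B C ∧ ∀ i, (A i).card = 1 ∧ (B i).card = 2 ∧ (C i).card = 2 :=
  not_exists_isSTPP_122_of_card_le_hi45 (by norm_num) noneList122K4_of_capped not_122pow4_of_mem_noneLists122K4 hG

/-- **ONSET BOUNDS for `(1,2,2)⁴`** over all finite abelian groups (kernel): no host of order `≤ 27`, and `ℤ/2 × ℤ/16` (order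
`32`) hosts (`STPPSmallPatternT2K4Order32.lean`). [cite: CohnKleinbergSzegedyUmans2005, Def. 5.1] -/
theorem stpp122pow4_onset_bounds :
    (∀ (G : Type) [AddCommGroup G] [Finite G], Nat.card G ≤ 27 →
      ¬ ∃ A B C : Fin 4 → Finset G, IsSTPP A B C ∧ ∀ i, (A i).card = 1 ∧ (B i).card = 2 ∧ (C i).card = 2) ∧
    ∃ A B C : Fin 4 → Finset (ZMod 2 × ZMod 16), IsSTPP A B C ∧ ∀ i, (A i).card = 1 ∧ (B i).card = 2 ∧ (C i).card = 2 :=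
  ⟨fun _ _ _ hG => not_exists_isSTPP_122pow4_of_card_le hG, exists_isSTPP_122pow4_zmod2_zmod16⟩

/-! ## 4. `T2 = 3` exactly at every abelian group of order `24 … 27` -/

/-- **`T2(ℤ/26) = 3` exactly, in the kernel.** [cite: CohnKleinbergSzegedyUmans2005, Def. 5.1] -/
theorem stpp122_T2_zmod26_eq_3 :
    (∃ A B C : Fin 3 → Finset (ZMod 26), IsSTPP A B C ∧ ∀ i, (A i).card = 1 ∧ (B i).card = 2 ∧ (C i).card = 2) ∧
    ¬ ∃ A B C : Fin 4 → Finset (ZMod 26), IsSTPP A B C ∧ ∀ i, (A i).card = 1 ∧ (B i).card = 2 ∧ (C i).card = 2 :=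
  ⟨exists_isSTPP_122pow3_zmod26, not_exists_isSTPP_122pow4_zmod26⟩

/-- **`T2 = 3` EXACTLY at each of the nine abelian groups of order `24 … 27`** (kernel both ways): `ℤ/24`, `ℤ/2 × ℤ/12`,
`ℤ/2² × ℤ/6`, `ℤ/25`, `ℤ/5²`, `ℤ/26`, `ℤ/27`, `ℤ/3 × ℤ/9`, `(ℤ/3)³` each host `(1,2,2)³` and none hosts `(1,2,2)⁴`.
[cite: CohnKleinbergSzegedyUmans2005, Def. 5.1] -/
theorem stpp122_T2_eq_3_orders_24_27 :
    ((∃ A B C : Fin 3 → Finset (ZMod 24), IsSTPP A B C ∧ ∀ i, (A i).card = 1 ∧ (B i).card = 2 ∧ (C i).card = 2) ∧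
      ¬ ∃ A B C : Fin 4 → Finset (ZMod 24), IsSTPP A B C ∧ ∀ i, (A i).card = 1 ∧ (B i).card = 2 ∧ (C i).card = 2) ∧
    ((∃ A B C : Fin 3 → Finset (ZMod 2 × ZMod 12), IsSTPP A B C ∧ ∀ i, (A i).card = 1 ∧ (B i).card = 2 ∧ (C i).card = 2) ∧
      ¬ ∃ A B C : Fin 4 → Finset (ZMod 2 × ZMod 12), IsSTPP A B C ∧ ∀ i, (A i).card = 1 ∧ (B i).card = 2 ∧ (C i).card = 2) ∧
    ((∃ A B C : Fin 3 → Finset (ZMod 2 × (ZMod 2 × ZMod 6)), IsSTPP A B C ∧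
        ∀ i, (A i).card = 1 ∧ (B i).card = 2 ∧ (C i).card = 2) ∧
      ¬ ∃ A B C : Fin 4 → Finset (ZMod 2 × (ZMod 2 × ZMod 6)), IsSTPP A B C ∧
        ∀ i, (A i).card = 1 ∧ (B i).card = 2 ∧ (C i).card = 2) ∧
    ((∃ A B C : Fin 3 → Finset (ZMod 25), IsSTPP A B C ∧ ∀ i, (A i).card = 1 ∧ (B i).card = 2 ∧ (C i).card = 2) ∧
      ¬ ∃ A B C : Fin 4 → Finset (ZMod 25), IsSTPP A B C ∧ ∀ i, (A i).card = 1 ∧ (B i).card = 2 ∧ (C i).card = 2) ∧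
    ((∃ A B C : Fin 3 → Finset (ZMod 5 × ZMod 5), IsSTPP A B C ∧ ∀ i, (A i).card = 1 ∧ (B i).card = 2 ∧ (C i).card = 2) ∧
      ¬ ∃ A B C : Fin 4 → Finset (ZMod 5 × ZMod 5), IsSTPP A B C ∧ ∀ i, (A i).card = 1 ∧ (B i).card = 2 ∧ (C i).card = 2) ∧
    ((∃ A B C : Fin 3 → Finset (ZMod 26), IsSTPP A B C ∧ ∀ i, (A i).card = 1 ∧ (B i).card = 2 ∧ (C i).card = 2) ∧
      ¬ ∃ A B C : Fin 4 → Finset (ZMod 26), IsSTPP A B C ∧ ∀ i, (A i).card = 1 ∧ (B i).card = 2 ∧ (C i).card = 2) ∧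
    ((∃ A B C : Fin 3 → Finset (ZMod 27), IsSTPP A B C ∧ ∀ i, (A i).card = 1 ∧ (B i).card = 2 ∧ (C i).card = 2) ∧
      ¬ ∃ A B C : Fin 4 → Finset (ZMod 27), IsSTPP A B C ∧ ∀ i, (A i).card = 1 ∧ (B i).card = 2 ∧ (C i).card = 2) ∧
    ((∃ A B C : Fin 3 → Finset (ZMod 3 × ZMod 9), IsSTPP A B C ∧ ∀ i, (A i).card = 1 ∧ (B i).card = 2 ∧ (C i).card = 2) ∧
      ¬ ∃ A B C : Fin 4 → Finset (ZMod 3 × ZMod 9), IsSTPP A B C ∧ ∀ i, (A i).card = 1 ∧ (B i).card = 2 ∧ (C i).card = 2) ∧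
    ((∃ A B C : Fin 3 → Finset (ZMod 3 × (ZMod 3 × ZMod 3)), IsSTPP A B C ∧
        ∀ i, (A i).card = 1 ∧ (B i).card = 2 ∧ (C i).card = 2) ∧
      ¬ ∃ A B C : Fin 4 → Finset (ZMod 3 × (ZMod 3 × ZMod 3)), IsSTPP A B C ∧
        ∀ i, (A i).card = 1 ∧ (B i).card = 2 ∧ (C i).card = 2) :=
  ⟨stpp122_T2_zmod24_eq_3, stpp122_T2_z2_z12_eq_3, stpp122_T2_z2_z2_z6_eq_3, stpp122_T2_zmod25_eq_3, stpp122_T2_z5_z5_eq_3,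
    stpp122_T2_zmod26_eq_3, stpp122_T2_zmod27_eq_3, stpp122_T2_z3_z9_eq_3, stpp122_T2_z3_z3_z3_eq_3⟩

end Summit.MatrixMultiplication.OmegaCensus
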